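import Mathlib
import HarnessLib

/-!
# Sampling Riesz-type products at equally spaced points (discrete Gallagher bound)

Topic `Literature/Analysis/Fourier`. Let `w_i : ℝ → [0, 2]` (`i ∈ ℕ`) be 1-periodic, `L`-Lipschitz
weights and `R_m(u) = ∏_{i<m} w_i(2^i u)` the associated Riesz-type product along the dilations
`2^i` (the model case is `w_i(x) = |1 ± e(x)|`, `e(x) = exp(2πix)`, for which `R_m = |∏ (1 ± e(2^i u))|`
is the modulus of a classical Riesz product / of the Fourier transform of a Walsh sign pattern).
Suppose the DYADIC averages of all shifted products are controlled,
`∑_{r<2^m} ∏_{i<m} w_{s+i}(2^i (φ+r)/2^m) ≤ 2·2^m·K^m` for every shift `s`, level `m` and base point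
`φ` (`K ≥ 1`). The main result `sum_prod_sample_le_of_dyadic_avg` transfers this to the `N` equally
spaced sample points `k/N`, `k < N`, at the natural density `2^m ≤ 4N`:
`∑_{k<N} R_m(k/N) ≤ (5 + 16L) · N · K^m`.

This is a purely discrete form of the Gallagher / Marcinkiewicz–Zygmund sampling inequality
(a large-sieve-type `ℓ¹` comparison between a well-spaced sample and an average), organised as:
* `abs_prod_range_sub_prod_range_le` — telescoping `|∏ b - ∏ a| ≤ ∑_j |b_j - a_j| ∏_{i<j} b_i ∏_{i>j} a_i`
  (from `Finset.prod_add_ordered`);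
* `sum_prod_dyadic_le_of_coarse` — dyadic averages over finer meshes `2^{M'}`, `M' ≥ m`;
* `sum_prod_lower_mul_prod_upper_le` — the residue-class grouping of
  `∑_r (∏_{i<j} w_i(2^i(r+1)/2^M)) (∏_{j<i<m} w_i(2^i r/2^M))` into a level-`j` times a
  level-`(m-j-1)` average;
* `sum_abs_prod_succ_sub_prod_le` — the mesh variation `∑_r |R((r+1)/2^M) - R(r/2^M)| ≤ 4L 2^m K^m`;
* `abs_prod_sub_prod_le_mul_abs_sub` — `R_m` is `L·4^m`-Lipschitz (rounding to the mesh);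
* `card_mul_le_sum_add_card_mul_variation`, `sum_sum_windows_le` — discrete Sobolev on a window and
  disjointness of the windows `⌊2^M k/N⌋ + [0, ⌊2^M/N⌋)`;
* `sum_prod_sample_le_of_dyadic_avg` — assembly.
Everything is elementary and fully proved (finite sums only, no integrals); no named facts.
Sources for the underlying inequality: P. X. Gallagher, *The large sieve*, Mathematika 14 (1967),
Lemma 1; H. L. Montgomery, *Ten lectures on the interface between analytic number theory and
harmonic analysis* (1994), Ch. 1 and Ch. 7 §3. [folklore]
-/

open Finset

namespace Literature.Analysis.Fourier

/-- **Telescoping bound for a difference of products of non-negative reals.**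
`|∏_{i<m} b i - ∏_{i<m} a i| ≤ ∑_{j<m} |b j - a j| · (∏_{i<j} b i) · ∏_{j<i<m} a i`. [folklore] -/
theorem abs_prod_range_sub_prod_range_le (m : ℕ) (a b : ℕ → ℝ)
    (ha : ∀ i, 0 ≤ a i) (hb : ∀ i, 0 ≤ b i) :
    |∏ i ∈ range m, b i - ∏ i ∈ range m, a i| ≤
      ∑ j ∈ range m, |b j - a j| * (∏ i ∈ range j, b i) * ∏ i ∈ Ico (j + 1) m, a i := by
  have h := Finset.prod_add_ordered (range m) a (fun i => b i - a i)
  simp only [add_sub_cancel] at h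
  have hlt : ∀ j ∈ range m, (range m).filter (· < j) = range j := by
    intro j hj
    ext i
    simp only [mem_filter, mem_range] at hj ⊢
    omega
  have hgt : ∀ j ∈ range m, (range m).filter (j < ·) = Ico (j + 1) m := by
    intro j hj
    ext i
    simp only [mem_filter, mem_range, mem_Ico]
    omega
  rw [h, add_sub_cancel_left]
  refine (abs_sum_le_sum_abs _ _).trans (le_of_eq (Finset.sum_congr rfl fun j hj => ?_))
  rw [hlt j hj, hgt j hj, abs_mul, abs_mul, abs_of_nonneg (prod_nonneg fun i _ => hb i),
    abs_of_nonneg (prod_nonneg fun i _ => ha i)]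

/-- Splitting a sum over `range (a * b)` along `r = x + a * y`, `x < a`, `y < b`. [folklore] -/
theorem sum_range_mul_eq_sum_sum (a b : ℕ) (F : ℕ → ℝ) :
    ∑ r ∈ range (a * b), F r = ∑ x ∈ range a, ∑ y ∈ range b, F (x + a * y) := by
  induction b with
  | zero => simp
  | succ b ih =>
    rw [Nat.mul_succ, sum_range_add, ih, ← sum_add_distrib]
    refine Finset.sum_congr rfl fun x _ => ?_
    rw [sum_range_succ, add_comm (a * b) x]


/-- `∑_{j<m} 2^j < 2^m`. [folklore] -/
theorem sum_range_two_pow_lt (m : ℕ) : ∑ j ∈ range m, (2 : ℝ) ^ j < 2 ^ m := by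
  induction m with
  | zero => simp
  | succ m ih => rw [sum_range_succ, pow_succ]; linarith

/-- **Dyadic averages at finer denominators.** If the level-`m` dyadic averages
`∑_{r<2^m} ∏_{i<m} w_{s+i}(2^i (φ' + r)/2^m)` are `≤ 2·2^m·C` for every base point `φ'`, then so are
the averages over any finer dyadic mesh `2^{M'}`, `m ≤ M'` (split `r = x + 2^{M'-m} y`). [folklore] -/
theorem sum_prod_dyadic_le_of_coarse (w : ℕ → ℝ → ℝ) (s m M' : ℕ) (C φ : ℝ) (hmM : m ≤ M')
    (havg : ∀ φ' : ℝ, ∑ r ∈ range (2 ^ m), ∏ i ∈ range m,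
        w (s + i) (2 ^ i * ((φ' + r) / 2 ^ m)) ≤ 2 * 2 ^ m * C) :
    ∑ r ∈ range (2 ^ M'), ∏ i ∈ range m, w (s + i) (2 ^ i * ((φ + r) / 2 ^ M')) ≤
      2 * 2 ^ M' * C := by
  obtain ⟨d, rfl⟩ := Nat.exists_eq_add_of_le hmM
  rw [pow_add, mul_comm (2 ^ m) (2 ^ d), sum_range_mul_eq_sum_sum]
  have key : ∀ x ∈ range (2 ^ d), ∑ y ∈ range (2 ^ m), ∏ i ∈ range m,
      w (s + i) (2 ^ i * ((φ + ((x + 2 ^ d * y : ℕ) : ℝ)) / 2 ^ (m + d))) ≤ 2 * 2 ^ m * C := by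
    intro x _
    refine (Finset.sum_congr rfl fun y _ => Finset.prod_congr rfl fun i _ => ?_).trans_le
      (havg ((φ + x) / 2 ^ d))
    congr 1
    push_cast
    rw [pow_add]
    field_simp
    ring
  refine (Finset.sum_le_sum key).trans (le_of_eq ?_)
  rw [sum_const, card_range, nsmul_eq_mul]
  push_cast
  ring

/-- **Grouping lemma.** For `j < m ≤ M`, writing the mesh index as `r = ℓ + 2^{M-j-1} t` makes the
upper partial product `∏_{j<i<m} w_i(2^i r/2^M)` depend on `ℓ` only (1-periodicity) and turns the
lower partial product `∏_{i<j} w_i(2^i (r+1)/2^M)` into a level-`j` dyadic average in `t`; hence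
`∑_{r<2^M} (lower)·(upper) ≤ (2·2^{j+1} K^j)(2·2^{M-j-1} K^{m-j-1})`. [folklore] -/
theorem sum_prod_lower_mul_prod_upper_le (w : ℕ → ℝ → ℝ) (K : ℝ) (hK : 0 ≤ K)
    (hw0 : ∀ i x, 0 ≤ w i x) (hper : ∀ (i : ℕ) (x : ℝ) (n : ℕ), w i (x + n) = w i x)
    (havg : ∀ (s m : ℕ) (φ : ℝ), ∑ r ∈ range (2 ^ m), ∏ i ∈ range m,
        w (s + i) (2 ^ i * ((φ + r) / 2 ^ m)) ≤ 2 * 2 ^ m * K ^ m)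
    (j m M : ℕ) (hjm : j < m) (hmM : m ≤ M) :
    ∑ r ∈ range (2 ^ M), (∏ i ∈ range j, w i (2 ^ i * (((r : ℝ) + 1) / 2 ^ M))) *
        ∏ i ∈ Ico (j + 1) m, w i (2 ^ i * ((r : ℝ) / 2 ^ M)) ≤
      4 * 2 ^ M * (K ^ j * K ^ (m - j - 1)) := by
  obtain ⟨e, rfl⟩ : ∃ e, M = (j + 1) + e := Nat.exists_eq_add_of_le (by omega)
  rw [pow_add 2 (j + 1) e, mul_comm (2 ^ (j + 1)) (2 ^ e), sum_range_mul_eq_sum_sum]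
  have hup : ∀ ℓ t : ℕ, ∏ i ∈ Ico (j + 1) m,
      w i (2 ^ i * (((ℓ + 2 ^ e * t : ℕ) : ℝ) / 2 ^ (j + 1 + e))) =
      ∏ i ∈ range (m - (j + 1)), w (j + 1 + i) (2 ^ i * (((0 : ℝ) + ℓ) / 2 ^ e)) := by
    intro ℓ t
    rw [prod_Ico_eq_prod_range]
    refine Finset.prod_congr rfl fun i _ => ?_
    rw [← hper (j + 1 + i) (2 ^ i * (((0 : ℝ) + ℓ) / 2 ^ e)) (2 ^ i * t)]
    congr 1
    push_cast
    simp only [pow_add]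
    field_simp
    ring
  have hlow : ∀ ℓ ∈ range (2 ^ e), ∑ t ∈ range (2 ^ (j + 1)), ∏ i ∈ range j,
      w i (2 ^ i * ((((ℓ + 2 ^ e * t : ℕ) : ℝ) + 1) / 2 ^ (j + 1 + e))) ≤
      2 * 2 ^ (j + 1) * K ^ j := by
    intro ℓ _
    have h := sum_prod_dyadic_le_of_coarse w 0 j (j + 1) (K ^ j) (((ℓ : ℝ) + 1) / 2 ^ e)
      (by omega) (havg 0 j)
    simp only [zero_add] at h
    refine (Finset.sum_congr rfl fun t _ => Finset.prod_congr rfl fun i _ => ?_).trans_le h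
    congr 1
    push_cast
    simp only [pow_add]
    field_simp
    ring
  have hB : ∑ ℓ ∈ range (2 ^ e), ∏ i ∈ range (m - (j + 1)),
      w (j + 1 + i) (2 ^ i * (((0 : ℝ) + ℓ) / 2 ^ e)) ≤ 2 * 2 ^ e * K ^ (m - (j + 1)) :=
    sum_prod_dyadic_le_of_coarse w (j + 1) (m - (j + 1)) e (K ^ (m - (j + 1))) 0 (by omega)
      (havg (j + 1) (m - (j + 1)))
  calc ∑ ℓ ∈ range (2 ^ e), ∑ t ∈ range (2 ^ (j + 1)),
        (∏ i ∈ range j, w i (2 ^ i * ((((ℓ + 2 ^ e * t : ℕ) : ℝ) + 1) / 2 ^ (j + 1 + e)))) *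
          ∏ i ∈ Ico (j + 1) m, w i (2 ^ i * (((ℓ + 2 ^ e * t : ℕ) : ℝ) / 2 ^ (j + 1 + e)))
      = ∑ ℓ ∈ range (2 ^ e), (∏ i ∈ range (m - (j + 1)),
          w (j + 1 + i) (2 ^ i * (((0 : ℝ) + ℓ) / 2 ^ e))) *
          ∑ t ∈ range (2 ^ (j + 1)), ∏ i ∈ range j,
            w i (2 ^ i * ((((ℓ + 2 ^ e * t : ℕ) : ℝ) + 1) / 2 ^ (j + 1 + e))) := by
        refine Finset.sum_congr rfl fun ℓ _ => ?_
        rw [Finset.mul_sum]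
        refine Finset.sum_congr rfl fun t _ => ?_
        rw [hup ℓ t, mul_comm]
    _ ≤ ∑ ℓ ∈ range (2 ^ e), (∏ i ∈ range (m - (j + 1)),
          w (j + 1 + i) (2 ^ i * (((0 : ℝ) + ℓ) / 2 ^ e))) * (2 * 2 ^ (j + 1) * K ^ j) := by
        gcongr with ℓ hℓ
        · exact prod_nonneg fun i _ => hw0 _ _
        · exact hlow ℓ hℓ
    _ ≤ (2 * 2 ^ e * K ^ (m - (j + 1))) * (2 * 2 ^ (j + 1) * K ^ j) := by
        rw [← Finset.sum_mul]
        gcongr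
    _ = 4 * 2 ^ (j + 1 + e) * (K ^ j * K ^ (m - j - 1)) := by
        rw [show m - j - 1 = m - (j + 1) by omega, pow_add]
        ring

/-- **Variation of the product along the mesh.** Telescoping over the scales
(`|w_j(2^j(r+1)/2^M) - w_j(2^j r/2^M)| ≤ L 2^j / 2^M`) and the grouping lemma give
`∑_{r<2^M} |R((r+1)/2^M) - R(r/2^M)| ≤ 4 L 2^m K^m` (`K ≥ 1`). [folklore] -/
theorem sum_abs_prod_succ_sub_prod_le (w : ℕ → ℝ → ℝ) (K L : ℝ) (hK : 1 ≤ K) (hL : 0 ≤ L)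
    (hw0 : ∀ i x, 0 ≤ w i x) (hper : ∀ (i : ℕ) (x : ℝ) (n : ℕ), w i (x + n) = w i x)
    (hlip : ∀ (i : ℕ) (x y : ℝ), |w i x - w i y| ≤ L * |x - y|)
    (havg : ∀ (s m : ℕ) (φ : ℝ), ∑ r ∈ range (2 ^ m), ∏ i ∈ range m,
        w (s + i) (2 ^ i * ((φ + r) / 2 ^ m)) ≤ 2 * 2 ^ m * K ^ m)
    (m M : ℕ) (hmM : m ≤ M) :
    ∑ r ∈ range (2 ^ M), |∏ i ∈ range m, w i (2 ^ i * (((r : ℝ) + 1) / 2 ^ M)) -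
        ∏ i ∈ range m, w i (2 ^ i * ((r : ℝ) / 2 ^ M))| ≤ 4 * L * 2 ^ m * K ^ m := by
  have hpt : ∀ r : ℕ, |∏ i ∈ range m, w i (2 ^ i * (((r : ℝ) + 1) / 2 ^ M)) -
      ∏ i ∈ range m, w i (2 ^ i * ((r : ℝ) / 2 ^ M))| ≤
      ∑ j ∈ range m, L * 2 ^ j / 2 ^ M *
        ((∏ i ∈ range j, w i (2 ^ i * (((r : ℝ) + 1) / 2 ^ M))) *
          ∏ i ∈ Ico (j + 1) m, w i (2 ^ i * ((r : ℝ) / 2 ^ M))) := by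
    intro r
    refine (abs_prod_range_sub_prod_range_le m (fun i => w i (2 ^ i * ((r : ℝ) / 2 ^ M)))
      (fun i => w i (2 ^ i * (((r : ℝ) + 1) / 2 ^ M))) (fun i => hw0 _ _)
      (fun i => hw0 _ _)).trans (Finset.sum_le_sum fun j _ => ?_)
    rw [mul_assoc]
    refine mul_le_mul_of_nonneg_right ((hlip j _ _).trans (le_of_eq ?_))
      (mul_nonneg (prod_nonneg fun i _ => hw0 _ _) (prod_nonneg fun i _ => hw0 _ _))
    rw [← mul_sub, abs_mul, abs_of_pos (by positivity : (0 : ℝ) < 2 ^ j),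
      show ((r : ℝ) + 1) / 2 ^ M - r / 2 ^ M = 1 / 2 ^ M by ring, abs_of_pos (by positivity)]
    ring
  refine (Finset.sum_le_sum fun r _ => hpt r).trans ?_
  rw [Finset.sum_comm]
  calc ∑ j ∈ range m, ∑ r ∈ range (2 ^ M), L * 2 ^ j / 2 ^ M *
        ((∏ i ∈ range j, w i (2 ^ i * (((r : ℝ) + 1) / 2 ^ M))) *
          ∏ i ∈ Ico (j + 1) m, w i (2 ^ i * ((r : ℝ) / 2 ^ M)))
      = ∑ j ∈ range m, L * 2 ^ j / 2 ^ M * ∑ r ∈ range (2 ^ M),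
          ((∏ i ∈ range j, w i (2 ^ i * (((r : ℝ) + 1) / 2 ^ M))) *
            ∏ i ∈ Ico (j + 1) m, w i (2 ^ i * ((r : ℝ) / 2 ^ M))) := by
        simp_rw [Finset.mul_sum]
    _ ≤ ∑ j ∈ range m, L * 2 ^ j / 2 ^ M * (4 * 2 ^ M * (K ^ j * K ^ (m - j - 1))) := by
        gcongr with j hj
        exact sum_prod_lower_mul_prod_upper_le w K (by linarith) hw0 hper havg j m M
          (mem_range.1 hj) hmM
    _ ≤ ∑ j ∈ range m, L * 2 ^ j / 2 ^ M * (4 * 2 ^ M * K ^ m) := by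
        gcongr with j hj
        rw [← pow_add]
        exact pow_le_pow_right₀ hK (by have := mem_range.1 hj; omega)
    _ = 4 * L * K ^ m * ∑ j ∈ range m, (2 : ℝ) ^ j := by
        rw [Finset.mul_sum]
        refine Finset.sum_congr rfl fun j _ => ?_
        field_simp
    _ ≤ 4 * L * K ^ m * 2 ^ m := by gcongr; exact (sum_range_two_pow_lt m).le
    _ = 4 * L * 2 ^ m * K ^ m := by ring

/-- **Lipschitz bound for the full product**: all factors lie in `[0, 2]` and the `i`-th is
`L 2^i`-Lipschitz, so `|R(v) - R(u)| ≤ L · 4^m · |v - u|`. [folklore] -/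
theorem abs_prod_sub_prod_le_mul_abs_sub (w : ℕ → ℝ → ℝ) (L : ℝ) (hL : 0 ≤ L)
    (hw0 : ∀ i x, 0 ≤ w i x) (hw2 : ∀ i x, w i x ≤ 2)
    (hlip : ∀ (i : ℕ) (x y : ℝ), |w i x - w i y| ≤ L * |x - y|) (m : ℕ) (u v : ℝ) :
    |∏ i ∈ range m, w i (2 ^ i * v) - ∏ i ∈ range m, w i (2 ^ i * u)| ≤
      L * 4 ^ m * |v - u| := by
  refine (abs_prod_range_sub_prod_range_le m (fun i => w i (2 ^ i * u)) (fun i => w i (2 ^ i * v))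
    (fun i => hw0 _ _) (fun i => hw0 _ _)).trans ?_
  have hA : ∀ j, ∏ i ∈ range j, w i (2 ^ i * v) ≤ 2 ^ j := fun j =>
    (prod_le_prod (fun i _ => hw0 _ _) (fun i _ => hw2 _ _)).trans (by simp)
  have hB : ∀ j, ∏ i ∈ Ico (j + 1) m, w i (2 ^ i * u) ≤ 2 ^ (m - (j + 1)) := fun j =>
    (prod_le_prod (fun i _ => hw0 _ _) (fun i _ => hw2 _ _)).trans (by simp)
  calc ∑ j ∈ range m, |w j (2 ^ j * v) - w j (2 ^ j * u)| *
        (∏ i ∈ range j, w i (2 ^ i * v)) * ∏ i ∈ Ico (j + 1) m, w i (2 ^ i * u)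
      ≤ ∑ j ∈ range m, (L * 2 ^ j * |v - u|) * 2 ^ m := by
        refine Finset.sum_le_sum fun j hj => ?_
        have hj' := mem_range.1 hj
        rw [mul_assoc]
        refine mul_le_mul ((hlip j _ _).trans (le_of_eq ?_)) ?_
          (mul_nonneg (prod_nonneg fun i _ => hw0 _ _) (prod_nonneg fun i _ => hw0 _ _))
          (by positivity)
        · rw [← mul_sub, abs_mul, abs_of_pos (by positivity : (0 : ℝ) < 2 ^ j), mul_assoc]
        · calc (∏ i ∈ range j, w i (2 ^ i * v)) * ∏ i ∈ Ico (j + 1) m, w i (2 ^ i * u)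
              ≤ 2 ^ j * 2 ^ (m - (j + 1)) :=
                mul_le_mul (hA j) (hB j) (prod_nonneg fun i _ => hw0 _ _) (by positivity)
            _ = 2 ^ (j + (m - (j + 1))) := (pow_add _ _ _).symm
            _ ≤ 2 ^ m := pow_le_pow_right₀ (by norm_num) (by omega)
    _ = L * |v - u| * 2 ^ m * ∑ j ∈ range m, (2 : ℝ) ^ j := by
        rw [Finset.mul_sum]
        exact Finset.sum_congr rfl fun j _ => by ring
    _ ≤ L * |v - u| * 2 ^ m * 2 ^ m := by gcongr; exact (sum_range_two_pow_lt m).le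
    _ = L * 4 ^ m * |v - u| := by
        rw [show (4 : ℝ) ^ m = 2 ^ m * 2 ^ m by rw [← mul_pow]; norm_num]
        ring

/-- **Discrete Sobolev inequality on a window**: `B · g(r) ≤ ∑_{i<B} g(r+i) + B · ∑_{i<B} |Δg(r+i)|`
(chain `g(r) ≤ g(r+i) + ∑_{i'<i} |g(r+i'+1) - g(r+i')|` and average over `i < B`). [folklore] -/
theorem card_mul_le_sum_add_card_mul_variation (g : ℕ → ℝ) (r B : ℕ) :
    (B : ℝ) * g r ≤ ∑ i ∈ range B, g (r + i) + B * ∑ i ∈ range B, |g (r + i + 1) - g (r + i)| := by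
  have hchain : ∀ i, g r ≤ g (r + i) + ∑ i' ∈ range i, |g (r + i' + 1) - g (r + i')| := by
    intro i
    induction i with
    | zero => simp
    | succ i ih =>
      rw [sum_range_succ, show r + (i + 1) = r + i + 1 from rfl]
      have h := neg_abs_le (g (r + i + 1) - g (r + i))
      linarith
  have hle : ∀ i ∈ range B,
      g r ≤ g (r + i) + ∑ i' ∈ range B, |g (r + i' + 1) - g (r + i')| := fun i hi =>
    (hchain i).trans (add_le_add le_rfl (sum_le_sum_of_subset_of_nonneg
      (range_subset_range.2 (mem_range.1 hi).le) fun _ _ _ => abs_nonneg _))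
  calc (B : ℝ) * g r = ∑ i ∈ range B, g r := by rw [sum_const, card_range, nsmul_eq_mul]
    _ ≤ ∑ i ∈ range B, (g (r + i) + ∑ i' ∈ range B, |g (r + i' + 1) - g (r + i')|) :=
        sum_le_sum hle
    _ = _ := by rw [sum_add_distrib, sum_const, card_range, nsmul_eq_mul]

/-- **Disjoint windows.** With `r_k = ⌊T k / N⌋` and `B = ⌊T / N⌋`, the windows
`{r_k + i : i < B}`, `k < N`, are pairwise disjoint subsets of `[0, T)`
(`r_k + B ≤ r_{k+1}`, `r_{N-1} + B ≤ T`), so for `G ≥ 0`: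
`∑_{k<N} ∑_{i<B} G (r_k + i) ≤ ∑_{r<T} G r`. [folklore] -/
theorem sum_sum_windows_le (N T : ℕ) (hN : 0 < N) (G : ℕ → ℝ) (hG : ∀ r, 0 ≤ G r) :
    ∑ k ∈ range N, ∑ i ∈ range (T / N), G (T * k / N + i) ≤ ∑ r ∈ range T, G r := by
  have hmono : ∀ k k', k < k' → T * k / N + T / N ≤ T * k' / N := fun k k' h =>
    (Nat.add_div_le_add_div _ _ _).trans
      (Nat.div_le_div_right (by rw [← Nat.mul_succ]; exact Nat.mul_le_mul_left _ h))
  have hinj : Set.InjOn (fun p : ℕ × ℕ => T * p.1 / N + p.2) ↑(range N ×ˢ range (T / N)) := by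
    rintro ⟨k, i⟩ hp ⟨k', i'⟩ hp' h
    simp only [coe_product, Set.mem_prod, mem_coe, mem_range] at hp hp' h
    rcases lt_trichotomy k k' with hk | rfl | hk
    · have := hmono k k' hk; omega
    · simp only [Prod.mk.injEq, true_and]; omega
    · have := hmono k' k hk; omega
  rw [← sum_product' (range N) (range (T / N)) (fun k i => G (T * k / N + i)),
    ← sum_image (f := G) hinj]
  refine sum_le_sum_of_subset_of_nonneg (fun r hr => ?_) (fun r _ _ => hG r)
  simp only [mem_image, mem_product, mem_range, Prod.exists] at hr
  obtain ⟨k, i, ⟨hk, hi⟩, rfl⟩ := hr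
  have h1 := hmono k N hk
  rw [Nat.mul_div_cancel _ hN] at h1
  exact mem_range.2 (by omega)

/-- **Sampling a Riesz-type product at `N` equally spaced points (discrete Gallagher /
Marcinkiewicz–Zygmund bound).** Let `w_i : ℝ → [0, 2]` be 1-periodic, `L`-Lipschitz weights whose
shifted dyadic averages obey `∑_{r<2^m} ∏_{i<m} w_{s+i}(2^i(φ+r)/2^m) ≤ 2·2^m·K^m` (`K ≥ 1`).
If `2^m ≤ 4N`, `2N ≤ 2^M`, `L·4^m ≤ 2^M` and `m ≤ M`, then
`∑_{k<N} ∏_{i<m} w_i(2^i k/N) ≤ (5 + 16 L) · N · K^m`.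
Proof: round `k/N` down to the mesh `2^{-M}ℤ` (cost `≤ 1` per point); the discrete Sobolev
inequality on the `N` disjoint windows of `⌊2^M/N⌋` mesh points bounds the rounded sum by the mesh
average (main term `≤ 4 N K^m`) plus the mesh variation (`≤ 4 L 2^m K^m ≤ 16 L N K^m`). [folklore] -/
theorem sum_prod_sample_le_of_dyadic_avg (w : ℕ → ℝ → ℝ) (K L : ℝ) (hK : 1 ≤ K) (hL : 0 ≤ L)
    (hw0 : ∀ i x, 0 ≤ w i x) (hw2 : ∀ i x, w i x ≤ 2)
    (hper : ∀ (i : ℕ) (x : ℝ) (n : ℕ), w i (x + n) = w i x)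
    (hlip : ∀ (i : ℕ) (x y : ℝ), |w i x - w i y| ≤ L * |x - y|)
    (havg : ∀ (s m : ℕ) (φ : ℝ), ∑ r ∈ range (2 ^ m), ∏ i ∈ range m,
        w (s + i) (2 ^ i * ((φ + r) / 2 ^ m)) ≤ 2 * 2 ^ m * K ^ m)
    (m N M : ℕ) (hN : 0 < N) (hmN : 2 ^ m ≤ 4 * N) (h2N : 2 * N ≤ 2 ^ M)
    (hLM : L * 4 ^ m ≤ 2 ^ M) (hmM : m ≤ M) :
    ∑ k ∈ range N, ∏ i ∈ range m, w i (2 ^ i * ((k : ℝ) / N)) ≤ (5 + 16 * L) * N * K ^ m := by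
  have hK0 : 0 < K := by linarith
  have hKm : 1 ≤ K ^ m := one_le_pow₀ hK
  have hN' : (N : ℝ) ≠ 0 := by positivity
  have hBpos : 0 < 2 ^ M / N := Nat.div_pos (by omega) hN
  have h2NB : (2 : ℝ) ^ M ≤ 2 * N * (2 ^ M / N : ℕ) := by
    have h1 := Nat.lt_div_mul_add (a := 2 ^ M) hN
    have h2 : N ≤ 2 ^ M / N * N := Nat.le_mul_of_pos_left N hBpos
    exact_mod_cast (by linarith : 2 ^ M ≤ 2 * N * (2 ^ M / N))
  obtain ⟨g, hg⟩ : ∃ g : ℕ → ℝ, ∀ r, g r = ∏ i ∈ range m, w i (2 ^ i * ((r : ℝ) / 2 ^ M)) :=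
    ⟨_, fun r => rfl⟩
  have hg0 : ∀ r, 0 ≤ g r := fun r => by rw [hg]; exact prod_nonneg fun i _ => hw0 _ _
  -- Step 1: rounding `k/N` down to the mesh point `⌊2^M k/N⌋ / 2^M`
  have hround : ∀ k : ℕ, ∏ i ∈ range m, w i (2 ^ i * ((k : ℝ) / N)) ≤ g (2 ^ M * k / N) + 1 := by
    intro k
    have hq1 : ((2 ^ M * k / N : ℕ) : ℝ) ≤ (2 : ℝ) ^ M * k / N := by
      simpa using Nat.cast_div_le (m := 2 ^ M * k) (n := N) (α := ℝ)
    have hq2 : (2 : ℝ) ^ M * k / N < ((2 ^ M * k / N : ℕ) : ℝ) + 1 := by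
      rw [div_lt_iff₀ (by positivity : (0 : ℝ) < N), add_mul, one_mul]
      exact_mod_cast Nat.lt_div_mul_add hN
    have hd : |(k : ℝ) / N - ((2 ^ M * k / N : ℕ) : ℝ) / 2 ^ M| ≤ 1 / 2 ^ M := by
      rw [show (k : ℝ) / N - ((2 ^ M * k / N : ℕ) : ℝ) / 2 ^ M
          = ((2 : ℝ) ^ M * k / N - ((2 ^ M * k / N : ℕ) : ℝ)) / 2 ^ M by field_simp,
        abs_div, abs_of_pos (by positivity : (0 : ℝ) < 2 ^ M)]
      gcongr
      exact abs_le.2 ⟨by linarith, by linarith⟩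
    have hdiff := abs_prod_sub_prod_le_mul_abs_sub w L hL hw0 hw2 hlip m
      (((2 ^ M * k / N : ℕ) : ℝ) / 2 ^ M) ((k : ℝ) / N)
    have h3 : L * 4 ^ m * |(k : ℝ) / N - ((2 ^ M * k / N : ℕ) : ℝ) / 2 ^ M| ≤ 1 := by
      calc _ ≤ L * 4 ^ m * (1 / 2 ^ M) := by gcongr
        _ ≤ 1 := by rw [mul_one_div, div_le_one (by positivity)]; exact hLM
    rw [hg]
    linarith [(abs_le.1 (hdiff.trans h3)).2]
  -- Step 2: the mesh average and the mesh variation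
  have hmain : ∑ r ∈ range (2 ^ M), g r ≤ 2 * 2 ^ M * K ^ m := by
    have h := sum_prod_dyadic_le_of_coarse w 0 m M (K ^ m) 0 hmM (havg 0 m)
    simp only [zero_add] at h
    simpa only [hg] using h
  have hvar : ∑ r ∈ range (2 ^ M), |g (r + 1) - g r| ≤ 4 * L * 2 ^ m * K ^ m := by
    have h := sum_abs_prod_succ_sub_prod_le w K L hK hL hw0 hper hlip havg m M hmM
    simp only [hg]
    push_cast
    exact h
  -- Step 3: discrete Sobolev on the disjoint windows
  have hsob : ((2 ^ M / N : ℕ) : ℝ) * ∑ k ∈ range N, g (2 ^ M * k / N) ≤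
      ∑ r ∈ range (2 ^ M), g r + ((2 ^ M / N : ℕ) : ℝ) * ∑ r ∈ range (2 ^ M), |g (r + 1) - g r| :=
    calc ((2 ^ M / N : ℕ) : ℝ) * ∑ k ∈ range N, g (2 ^ M * k / N)
        = ∑ k ∈ range N, ((2 ^ M / N : ℕ) : ℝ) * g (2 ^ M * k / N) := Finset.mul_sum _ _ _
      _ ≤ ∑ k ∈ range N, (∑ i ∈ range (2 ^ M / N), g (2 ^ M * k / N + i) +
            ((2 ^ M / N : ℕ) : ℝ) * ∑ i ∈ range (2 ^ M / N),
              |g (2 ^ M * k / N + i + 1) - g (2 ^ M * k / N + i)|) :=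
          sum_le_sum fun k _ => card_mul_le_sum_add_card_mul_variation g _ _
      _ = ∑ k ∈ range N, ∑ i ∈ range (2 ^ M / N), (g (2 ^ M * k / N + i) +
            ((2 ^ M / N : ℕ) : ℝ) * |g (2 ^ M * k / N + i + 1) - g (2 ^ M * k / N + i)|) := by
          refine sum_congr rfl fun k _ => ?_
          rw [sum_add_distrib, mul_sum]
      _ ≤ ∑ r ∈ range (2 ^ M), (g r + ((2 ^ M / N : ℕ) : ℝ) * |g (r + 1) - g r|) :=
          sum_sum_windows_le N (2 ^ M) hN (fun r => g r + ((2 ^ M / N : ℕ) : ℝ) * |g (r + 1) - g r|)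
            (fun r => add_nonneg (hg0 r) (by positivity))
      _ = _ := by rw [sum_add_distrib, mul_sum]
  have hmesh : ∑ k ∈ range N, g (2 ^ M * k / N) ≤ 4 * N * K ^ m + 4 * L * 2 ^ m * K ^ m := by
    refine le_of_mul_le_mul_left ?_ (by exact_mod_cast hBpos : (0 : ℝ) < (2 ^ M / N : ℕ))
    calc ((2 ^ M / N : ℕ) : ℝ) * ∑ k ∈ range N, g (2 ^ M * k / N)
        ≤ 2 * 2 ^ M * K ^ m + ((2 ^ M / N : ℕ) : ℝ) * (4 * L * 2 ^ m * K ^ m) :=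
          hsob.trans (add_le_add hmain (mul_le_mul_of_nonneg_left hvar (by positivity)))
      _ ≤ 2 * (2 * N * (2 ^ M / N : ℕ)) * K ^ m + ((2 ^ M / N : ℕ) : ℝ) * (4 * L * 2 ^ m * K ^ m) := by
          gcongr
      _ = ((2 ^ M / N : ℕ) : ℝ) * (4 * N * K ^ m + 4 * L * 2 ^ m * K ^ m) := by ring
  -- Step 4: assembly
  have h2m : (2 : ℝ) ^ m ≤ 4 * N := by exact_mod_cast hmN
  have e1 : 4 * L * 2 ^ m * K ^ m ≤ 4 * L * (4 * N) * K ^ m := by gcongr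
  have e2 : (N : ℝ) ≤ N * K ^ m := le_mul_of_one_le_right (by positivity) hKm
  calc ∑ k ∈ range N, ∏ i ∈ range m, w i (2 ^ i * ((k : ℝ) / N))
      ≤ ∑ k ∈ range N, (g (2 ^ M * k / N) + 1) := sum_le_sum fun k _ => hround k
    _ = ∑ k ∈ range N, g (2 ^ M * k / N) + N := by
        rw [sum_add_distrib, sum_const, card_range, nsmul_eq_mul, mul_one]
    _ ≤ 4 * N * K ^ m + 4 * L * 2 ^ m * K ^ m + N := by gcongr
    _ ≤ (5 + 16 * L) * N * K ^ m := by nlinarith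

end Literature.Analysis.Fourier
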